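import Summits.CriticalPhenomena.PercolationContinuityZ3.Theses.PercNearOneGluing
import Literature.Probability.Percolation.PercolationEvents
import HarnessLib.Audit
import Summits.CriticalPhenomena.PercolationContinuityZ3.Theorems.PercNearOneGluingNearOneGluingVariants2415
import Summits.CriticalPhenomena.PercolationContinuityZ3.Theorems.PercNearOneGluingNearOneGluingVariants2524

/-! TTRL-lite variant V2444 of stmt-CriticalPhenomena-4574

(`stub_shorteningStep` of line `kn_shortening_induction`, move `specialise+small_case`:
`n := 4` fixed and `A.card ≤ 3`).  This is the conjunction of two already-landed sibling
variants: for `A.card ≤ 2` it is V2415 (`stub_shorteningStep_var2415`, any `n`), and for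
`A.card = 3` it is V2524 (`stub_shorteningStep_var2524`, `n ≤ 4 ∧ A.card = 3`) at `n = 4`.
No new definitions, no named facts. -/

namespace Summit.CriticalPhenomena.PercolationContinuityZ3.Theorems

open MeasureTheory Set Literature.Probability.LatticeModels Literature.Probability.Percolation
open scoped Classical BigOperators

/-- TTRL-lite variant V2444 of `stub_shorteningStep` (stmt-CriticalPhenomena-4574, Kozma–Nitzan
shortening step, arXiv:2401.12397 Conjecture 6, against the old minimiser `a₀`): the inequality
`μ₁(⋃ a ∈ A, v ↔ a) · μ₁(a₀ ↔ b) ≤ μ₁(v ↔ b)` for the glued measure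
`μ₁ = prodBernoulli (w[s(v,x) ↦ 1])` on `Fin 4` with at most three relays.  Case split on
`A.card`: `≤ 2` is variant V2415, `= 3` is variant V2524 at `n = 4`. -/
theorem stub_shorteningStep_var2444 : ∀ (w : Sym2 (Fin 4) → unitInterval) (A : Finset (Fin 4)) (b v x a₀ : Fin 4), A.card ≤ 3 → v ∉ A → v ≠ x → w s(v, x) = 0 → a₀ ∈ A → (∀ a ∈ A, (prodBernoulli w).real (openConn a₀ b) ≤ (prodBernoulli w).real (openConn a b)) → (∀ w' : Sym2 (Fin 4) → unitInterval, (∀ e, w e = 0 → w' e = 0) → ∀ (A' : Finset (Fin 4)) (o' b' : Fin 4) (t : ℝ), (∀ a ∈ A', t ≤ (prodBernoulli w').real (openConn a b')) → (prodBernoulli w').real (⋃ a ∈ A', openConn o' a) * t ≤ (prodBernoulli w').real (openConn o' b')) → (prodBernoulli (Function.update w s(v, x) 1)).real (⋃ a ∈ A, openConn v a) * (prodBernoulli (Function.update w s(v, x) 1)).real (openConn a₀ b) ≤ (prodBernoulli (Function.update w s(v, x) 1)).real (openConn v b) := by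
  intro w A b v x a₀ hcard hvA hvx hw0 ha₀ hmin hIH
  rcases Nat.lt_or_ge A.card 3 with hlt | hge
  · -- at most two relays: variant V2415
    exact stub_shorteningStep_var2415 4 w A b v x a₀ (by omega) hvA hvx hw0 ha₀ hmin hIH
  · -- exactly three relays: variant V2524 at `n = 4`
    exact stub_shorteningStep_var2524 4 w A b v x a₀ le_rfl (by omega) hvA hvx hw0 ha₀ hmin hIH

end Summit.CriticalPhenomena.PercolationContinuityZ3.Theorems
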